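import Summits.QuantumFields.YangMills.Theorems.SwapVirialDeficitAnticommutingSections
import Summits.QuantumFields.YangMills.Theorems.SwapVirialDeficitNearlyCommutingThreeFloor
import Summits.QuantumFields.YangMills.Theorems.FemtoTransferGapRungW1upAlgebra
import Literature.MathematicalPhysics.QuantumLattice.SU2HaarSmallBallUpper
import HarnessLib

/-!
# The seam sectors `ε_c = −1` of the swap-glued ring: the σ-twisted four-letter event has product-Haar mass `≤ C·t⁸` (brick (B-iii) of the fixed-`L`
# swap ceiling; seat w2 g54's plan note, cell ym-idea-1 STATUS 06:57Z)
# (free-hands support of item stmt-QuantumFields-24197 `SwapVirialDeficit.SwapGluedStiffness`)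

In the seam sectors `(ε_a, ε_b, ε_c) = (ε, ε, −1)` of `Z^S = TT.twistTrace L β (2L)` the relations of `ℤ³ ⋊_σ ℤ` read, for the four letters
`(C 0, C 1, C 2, C 3) = (a, b, c, t)`: `a, b, c` pairwise commute, `t b t⁻¹ = ε a`, `t a t⁻¹ = ε b`, and `t c t⁻¹ = −c` — the `t`-letter ANTICOMMUTES with the
`c`-letter.  Keeping only `[a, c] ≈ 0`, `t c ≈ −c t` and the slaving `b ≈ t⁻¹(ε a)t`, the product-Haar mass of the event at tolerance `t` is at most
`(32 t³)·(256·coneConst³·t⁵) = 8192·coneConst³·t⁸` — one order SMALLER than the principal sectors' `≍ t⁷` (flat locus: `c, t` traceless with `Im t ⊥ Im c`,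
`a ∈ T_c`, `b` slaved: dimension `4`, codimension `8`).

* §1 `cone_le_of_inter_ball_subset`, `coneMeasure_singleton_zero`, `pi_cone_inter_piBall` — cone-measure plumbing;
* §2 ★ `pi_cone_minusTriple_le` — `cone³{x : ‖x₀x₁ − x₁x₀‖ ≤ t‖x₁‖, ‖x₂x₁ + x₁x₂‖ ≤ t‖x₂‖‖x₁‖} ≤ 256·coneConst³·t⁵` (`0 < t ≤ 1`; Fubini over the hub `x₁`:
  an almost anticommuting partner forces `|re x₁| ≤ (t/2)‖x₁‖` (✓`four_mul_re_sq_le_norm_anticomm_sq`), then the sections ✓`coneMeasure_comm_section_le'`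
  (`≤ 8c t²`) and ✓`coneMeasure_anti_section_le` (`≤ 4c t²`), and ✓`coneMeasure_reSlab_le` (`≤ 8c t`));
  ★ `haar_pi_minusTriple_le` — the same for three Haar letters of `SU(2)`: `Haar³{‖[q₀,q₁]‖ ≤ t, ‖q₂q₁ + q₁q₂‖ ≤ t} ≤ 256·coneConst³·t⁵`;
* §3 `norm_su2Quat_sub_one_sq`, ★ `haar_quatBall_le` (`Haar{u : ‖q(D₁)q(u) − q(D₂)‖ ≤ t} ≤ 32t³`, ✓`haarProbability_su2_two_sub_trace_lt_le` + left invariance);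
* §4 ★★ `haar_pi_sigmaTwisted_minus_le` — for ANY fixed `z ∈ SU(2)` (the sign: `z = 1` or ✓`negOne`) and `0 < t ≤ 1`:
  `Haar⁴{C | ‖[q(C 0), q(C 2)]‖ ≤ t ∧ ‖q(C 3)q(C 2) + q(C 2)q(C 3)‖ ≤ t ∧ ‖q(C 3)q(C 1) − q(z)q(C 0)q(C 3)‖ ≤ t} ≤ 8192·coneConst³·t⁸`
  (Fubini over the slaved letter `C 1` first, split `piFinSuccAbove … 1`); every σ-twisted event of a sector `(ε, ε, −)` asks MORE and is a subset.

HONEST LABEL: finite-dimensional Haar-volume bookkeeping toward a fixed-`L` prediction row (which sectors of `Z^S` are subleading); nothing about ⟨24197⟩, ⟨24194⟩,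
⟨24497⟩, ⟨24196⟩ or any rung is proved; the Yang–Mills mass gap is NOT proved; no summit is proved by a line.  THEOREMS ONLY (0 `def`, 0 `sorry`), standard axioms.
Width seat ym-line-sfw-p2-w2 g54 (cell ym-idea-1, free hands), `--supports stmt-QuantumFields-24197`.  References: [cite: tHooft1979]; [cite: GonzalezarroyoAltes1988]; [folklore].
-/

set_option autoImplicit false

noncomputable section

open MeasureTheory Quaternion Set
open scoped Quaternion ENNReal BigOperators
open Literature.MathematicalPhysics.QuantumLattice
open Literature.MathematicalPhysics.QuantumFieldTheory (haarProbability)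
open Summit.QuantumFields.YangMills.Theorems.FemtoTransferGap (SU2)
open Summit.QuantumFields.YangMills.Theorems.SwapTwistDeficit.ToronLog
open Summit.QuantumFields.YangMills.Theorems.ToronValleyVolume.NearlyCommutingCeiling
open Summit.QuantumFields.YangMills.Theorems.SwapVirialDeficit.AnticommutingSections
open Summit.QuantumFields.YangMills.Theorems.SwapVirialDeficit.NearlyCommutingThreeFloor (measurePreserving_proj_three)
open Literature.MathematicalPhysics.QuantumFieldTheory.Balaban1983to89.T4HaarSU2Translate (su2Quat_mul su2Quat_one su2Quat_quatToSU2 measurable_su2Quat)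

attribute [local instance] Literature.Analysis.FluidPDE.Tao2016.quatMeasurableSpace
  Literature.Analysis.FluidPDE.Tao2016.quatBorelSpace
  Literature.MathematicalPhysics.QuantumLattice.secondCountableTopology_su2

namespace Summit.QuantumFields.YangMills.Theorems.SwapVirialDeficit.SigmaTwistedMinusSectorCeiling

/-! ## §1 Cone-measure plumbing -/

/-- The cone measure only sees the unit ball: `A ∩ B ⊆ Q ⟹ cone A ≤ cone Q`. [folklore] -/
theorem cone_le_of_inter_ball_subset {A Q : Set ℍ} (h : A ∩ Metric.ball 0 1 ⊆ Q) : coneMeasure A ≤ coneMeasure Q := by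
  rw [coneMeasure, Measure.smul_apply, Measure.smul_apply, Measure.restrict_apply' Metric.isOpen_ball.measurableSet,
    Measure.restrict_apply' Metric.isOpen_ball.measurableSet, smul_eq_mul, smul_eq_mul]
  have hsub : A ∩ Metric.ball (0 : ℍ) 1 ⊆ Q ∩ Metric.ball (0 : ℍ) 1 := fun w hw => ⟨h hw, hw.2⟩
  gcongr

/-- A point is cone-null. [folklore] -/
theorem coneMeasure_singleton_zero : coneMeasure {(0 : ℍ)} = 0 := by
  rw [coneMeasure, Measure.smul_apply, Measure.restrict_apply' Metric.isOpen_ball.measurableSet, smul_eq_mul]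
  have : volume ({(0 : ℍ)} ∩ Metric.ball (0 : ℍ) 1) = 0 := measure_mono_null Set.inter_subset_left (measure_singleton _)
  rw [this, mul_zero]

/-- The cone measure of the unit ball is `1`. [folklore] -/
theorem coneMeasure_ball : coneMeasure (Metric.ball (0 : ℍ) 1) = 1 := by
  rw [coneMeasure_apply Metric.isOpen_ball.measurableSet subset_rfl, ENNReal.inv_mul_cancel volume_ball_quat_ne_zero volume_ball_quat_ne_top]

/-- The product cone measure only sees the product of unit balls. [folklore] -/
theorem pi_cone_inter_piBall {n : ℕ} (A : Set (Fin n → ℍ)) :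
    (Measure.pi fun _ : Fin n => coneMeasure) A ≤
      (Measure.pi fun _ : Fin n => coneMeasure) (A ∩ Set.pi Set.univ fun _ => Metric.ball (0 : ℍ) 1) := by
  haveI := isProbabilityMeasure_coneMeasure
  have hB : MeasurableSet (Set.pi Set.univ fun _ : Fin n => Metric.ball (0 : ℍ) 1) :=
    MeasurableSet.univ_pi fun _ => Metric.isOpen_ball.measurableSet
  have hfull : (Measure.pi fun _ : Fin n => coneMeasure) (Set.pi Set.univ fun _ : Fin n => Metric.ball (0 : ℍ) 1)ᶜ = 0 := by
    rw [measure_compl hB (measure_ne_top _ _), Measure.pi_pi]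
    simp [coneMeasure_ball]
  calc (Measure.pi fun _ : Fin n => coneMeasure) A
      ≤ (Measure.pi fun _ : Fin n => coneMeasure)
          ((A ∩ Set.pi Set.univ fun _ => Metric.ball (0 : ℍ) 1) ∪ (Set.pi Set.univ fun _ : Fin n => Metric.ball (0 : ℍ) 1)ᶜ) := by
        refine measure_mono fun x hx => ?_
        by_cases hxB : x ∈ Set.pi Set.univ fun _ : Fin n => Metric.ball (0 : ℍ) 1
        · exact Or.inl ⟨hx, hxB⟩
        · exact Or.inr hxB
    _ ≤ (Measure.pi fun _ : Fin n => coneMeasure) (A ∩ Set.pi Set.univ fun _ => Metric.ball (0 : ℍ) 1) +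
          (Measure.pi fun _ : Fin n => coneMeasure) (Set.pi Set.univ fun _ : Fin n => Metric.ball (0 : ℍ) 1)ᶜ :=
        measure_union_le _ _
    _ = _ := by rw [hfull, add_zero]

/-! ## §2 The triple `(a, c, t)`: `[a,c] ≈ 0` and `t c ≈ −c t` -/

/-- ★ **Cone-side triple bound.**  For `0 < t ≤ 1`:
`cone³{x : ‖x₀x₁ − x₁x₀‖ ≤ t‖x₁‖ ∧ ‖x₂x₁ + x₁x₂‖ ≤ t‖x₂‖‖x₁‖} ≤ 256·coneConst³·t⁵` (hub `x₁ = c`-letter, `x₀ = a`-letter, `x₂ = t`-letter). [folklore] -/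
theorem pi_cone_minusTriple_le {t : ℝ} (ht : 0 < t) (ht1 : t ≤ 1) :
    (Measure.pi fun _ : Fin 3 => coneMeasure)
        {x : Fin 3 → ℍ | ‖x 0 * x 1 - x 1 * x 0‖ ≤ t * ‖x 1‖ ∧ ‖x 2 * x 1 + x 1 * x 2‖ ≤ t * ‖x 2‖ * ‖x 1‖} ≤
      ENNReal.ofReal (256 * coneConst ^ 3 * t ^ 5) := by
  haveI := isProbabilityMeasure_coneMeasure
  have hc := coneConst_pos
  -- split off the hub coordinate `x 1`
  set P : Set (ℍ × (Fin 2 → ℍ)) :=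
    {p | ‖p.2 0 * p.1 - p.1 * p.2 0‖ ≤ t * ‖p.1‖ ∧ ‖p.2 1 * p.1 + p.1 * p.2 1‖ ≤ t * ‖p.2 1‖ * ‖p.1‖} with hP
  have hPm : MeasurableSet P := by
    have h1 : Measurable fun p : ℍ × (Fin 2 → ℍ) => p.1 := measurable_fst
    have h20 : Measurable fun p : ℍ × (Fin 2 → ℍ) => p.2 0 := (measurable_pi_apply 0).comp measurable_snd
    have h21 : Measurable fun p : ℍ × (Fin 2 → ℍ) => p.2 1 := (measurable_pi_apply 1).comp measurable_snd
    refine (measurableSet_le ((h20.mul h1).sub (h1.mul h20)).norm (h1.norm.const_mul t)).inter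
      (measurableSet_le ((h21.mul h1).add (h1.mul h21)).norm ((h21.norm.const_mul t).mul h1.norm))
  have e : {x : Fin 3 → ℍ | ‖x 0 * x 1 - x 1 * x 0‖ ≤ t * ‖x 1‖ ∧ ‖x 2 * x 1 + x 1 * x 2‖ ≤ t * ‖x 2‖ * ‖x 1‖} =
      (MeasurableEquiv.piFinSuccAbove (fun _ : Fin 3 => ℍ) 1) ⁻¹' P := by
    ext x; exact Iff.rfl
  rw [e, (measurePreserving_piFinSuccAbove (fun _ : Fin 3 => coneMeasure) 1).measure_preimage hPm.nullMeasurableSet,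
    Measure.prod_apply hPm]
  -- the sections over the hub `y = x 1` are products `A y × A′ y`
  set A : ℍ → Set ℍ := fun y => {w | ‖w * y - y * w‖ ≤ t * ‖y‖} with hA
  set A' : ℍ → Set ℍ := fun y => {w | ‖w * y + y * w‖ ≤ t * ‖w‖ * ‖y‖} with hA'
  have hAm : ∀ y, MeasurableSet (A y) := fun y =>
    measurableSet_le (((continuous_id.mul continuous_const).sub (continuous_const.mul continuous_id)).norm).measurable measurable_const
  have hA'm : ∀ y, MeasurableSet (A' y) := fun y =>
    measurableSet_le (((continuous_id.mul continuous_const).add (continuous_const.mul continuous_id)).norm).measurable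
      ((continuous_norm.const_mul t).mul continuous_const).measurable
  have hsec : ∀ y : ℍ, (Measure.pi fun _ : Fin 2 => coneMeasure) (Prod.mk y ⁻¹' P) = coneMeasure (A y) * coneMeasure (A' y) := by
    intro y
    have e2 : Prod.mk y ⁻¹' P = Set.pi Set.univ ![A y, A' y] := by
      ext z
      simp only [hP, hA, hA', Set.mem_preimage, Set.mem_setOf_eq, Set.mem_univ_pi, Fin.forall_fin_two, Matrix.cons_val_zero,
        Matrix.cons_val_one]
    rw [e2, Measure.pi_pi, Fin.prod_univ_two]
    simp only [Matrix.cons_val_zero, Matrix.cons_val_one]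
  simp_rw [hsec]
  -- pointwise bound on the integrand
  set S : Set ℍ := {y | 2 * |y.re| ≤ t * ‖y‖} with hS
  have hSm : MeasurableSet S :=
    measurableSet_le ((continuous_re.abs).const_mul 2).measurable (continuous_norm.const_mul t).measurable
  set K : ℝ≥0∞ := ENNReal.ofReal (coneConst * (8 * t ^ 2)) * ENNReal.ofReal (coneConst * (4 * t ^ 2)) with hK
  have hbound : ∀ y : ℍ, coneMeasure (A y) * coneMeasure (A' y) ≤
      ({(0 : ℍ)} : Set ℍ).indicator (fun _ => (1 : ℝ≥0∞)) y + S.indicator (fun _ => K) y := by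
    intro y
    by_cases hy0 : y = 0
    · subst hy0
      rw [Set.indicator_of_mem (Set.mem_singleton _)]
      calc coneMeasure (A 0) * coneMeasure (A' 0) ≤ 1 * 1 := mul_le_mul' (coneMeasure_le_one _) (coneMeasure_le_one _)
        _ = 1 := one_mul _
        _ ≤ _ := le_self_add
    rw [Set.indicator_of_notMem (show y ∉ ({(0 : ℍ)} : Set ℍ) by simpa using hy0), zero_add]
    have hyn : 0 < ‖y‖ := norm_pos_iff.2 hy0
    by_cases hre : 2 * |y.re| ≤ t * ‖y‖
    · -- the hub is almost traceless: both sections are thin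
      rw [Set.indicator_of_mem (show y ∈ S from hre)]
      have hIm : y.im ≠ 0 := by
        intro him
        have h1 : ‖y.im‖ = 0 := by rw [him, norm_zero]
        have h2 := re_sq_add_norm_im_sq y
        rw [h1] at h2
        have h3 : |y.re| ^ 2 = ‖y‖ ^ 2 := by rw [sq_abs]; nlinarith
        have h4 : |y.re| = ‖y‖ := (pow_left_inj₀ (abs_nonneg _) (norm_nonneg _) two_ne_zero).1 h3
        rw [h4] at hre
        nlinarith
      have hm : 0 < ‖y.im‖ := norm_pos_iff.2 hIm
      -- `‖y‖² ≤ 2‖Im y‖²`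
      have hratio : ‖y‖ ^ 2 ≤ 2 * ‖y.im‖ ^ 2 := by
        have h2 := re_sq_add_norm_im_sq y
        have h3 : (2 * |y.re|) ^ 2 ≤ (t * ‖y‖) ^ 2 := pow_le_pow_left₀ (by positivity) hre 2
        rw [mul_pow, sq_abs, mul_pow] at h3
        have ht2 : t ^ 2 ≤ 1 := by nlinarith
        nlinarith [sq_nonneg ‖y‖, mul_le_mul_of_nonneg_right ht2 (sq_nonneg ‖y‖)]
      have hAle : coneMeasure (A y) ≤ ENNReal.ofReal (coneConst * (8 * t ^ 2)) := by
        have hsub : A y ∩ Metric.ball 0 1 ⊆ {w : ℍ | ‖y * w - w * y‖ ≤ t * ‖y‖} := by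
          intro w hw
          have h1 : ‖w * y - y * w‖ ≤ t * ‖y‖ := hw.1
          show ‖y * w - w * y‖ ≤ t * ‖y‖
          rwa [norm_sub_rev]
        refine (cone_le_of_inter_ball_subset hsub).trans ((coneMeasure_comm_section_le' (by positivity) hIm).trans ?_)
        apply ENNReal.ofReal_le_ofReal
        apply mul_le_mul_of_nonneg_left _ hc.le
        rw [div_le_iff₀ (by positivity)]
        nlinarith [sq_nonneg t, mul_le_mul_of_nonneg_left hratio (sq_nonneg t)]
      have hA'le : coneMeasure (A' y) ≤ ENNReal.ofReal (coneConst * (4 * t ^ 2)) := by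
        have hsub : A' y ∩ Metric.ball 0 1 ⊆ {w : ℍ | ‖y * w + w * y‖ ≤ t * ‖y‖} := by
          intro w hw
          have h1 : ‖w * y + y * w‖ ≤ t * ‖w‖ * ‖y‖ := hw.1
          have hwb : ‖w‖ < 1 := by simpa using hw.2
          show ‖y * w + w * y‖ ≤ t * ‖y‖
          rw [add_comm]
          refine h1.trans ?_
          have : t * ‖w‖ * ‖y‖ ≤ t * 1 * ‖y‖ := by gcongr
          linarith
        refine (cone_le_of_inter_ball_subset hsub).trans ((coneMeasure_anti_section_le (by positivity) hIm).trans ?_)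
        apply le_of_eq
        congr 1
        field_simp
      exact mul_le_mul' hAle hA'le
    · -- the hub is not almost traceless: the anticommuting section is `{0}`
      have hA'0 : A' y ∩ Metric.ball 0 1 ⊆ {0} := by
        intro w hw
        have hw1 : ‖w * y + y * w‖ ≤ t * ‖w‖ * ‖y‖ := hw.1
        have h4 := four_mul_re_sq_le_norm_anticomm_sq w y
        have hsq : ‖w * y + y * w‖ ^ 2 ≤ (t * ‖w‖ * ‖y‖) ^ 2 := pow_le_pow_left₀ (norm_nonneg _) hw1 2
        have hlt : t * ‖y‖ < 2 * |y.re| := lt_of_not_ge hre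
        by_contra hw0
        have hwn : 0 < ‖w‖ := norm_pos_iff.2 hw0
        have h1 : (t * ‖y‖) ^ 2 < (2 * |y.re|) ^ 2 := pow_lt_pow_left₀ hlt (by positivity) two_ne_zero
        have h2 : (2 * |y.re|) ^ 2 = 4 * y.re ^ 2 := by rw [mul_pow, sq_abs]; ring
        rw [h2] at h1
        have h5 : 4 * y.re ^ 2 * ‖w‖ ^ 2 ≤ (t * ‖y‖) ^ 2 * ‖w‖ ^ 2 := by nlinarith
        have h6 : (4 * y.re ^ 2 - (t * ‖y‖) ^ 2) * ‖w‖ ^ 2 ≤ 0 := by nlinarith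
        have h7 : 0 < (4 * y.re ^ 2 - (t * ‖y‖) ^ 2) * ‖w‖ ^ 2 := mul_pos (by linarith) (by positivity)
        linarith
      have : coneMeasure (A' y) = 0 :=
        nonpos_iff_eq_zero.1 ((cone_le_of_inter_ball_subset hA'0).trans (le_of_eq coneMeasure_singleton_zero))
      rw [this, mul_zero]
      exact bot_le
  -- integrate the bound
  have hSle : coneMeasure S ≤ ENNReal.ofReal (coneConst * (16 * (t / 2))) := by
    have hsub : S ∩ Metric.ball 0 1 ⊆ {y : ℍ | |y.re| ≤ t / 2} := by
      intro y hy
      have h1 : 2 * |y.re| ≤ t * ‖y‖ := hy.1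
      have h2 : ‖y‖ < 1 := by simpa using hy.2
      show |y.re| ≤ t / 2
      nlinarith [abs_nonneg y.re, ht]
    exact (cone_le_of_inter_ball_subset hsub).trans (coneMeasure_reSlab_le (by positivity))
  calc ∫⁻ y, coneMeasure (A y) * coneMeasure (A' y) ∂coneMeasure
      ≤ ∫⁻ y, ({(0 : ℍ)} : Set ℍ).indicator (fun _ => (1 : ℝ≥0∞)) y + S.indicator (fun _ => K) y ∂coneMeasure :=
        lintegral_mono hbound
    _ = coneMeasure {(0 : ℍ)} + K * coneMeasure S := by
        rw [lintegral_add_left ((measurable_const.indicator (MeasurableSet.singleton _))), lintegral_indicator_const (MeasurableSet.singleton _),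
          lintegral_indicator_const hSm, one_mul]
    _ ≤ 0 + K * ENNReal.ofReal (coneConst * (16 * (t / 2))) := by
        rw [coneMeasure_singleton_zero]
        gcongr
    _ = ENNReal.ofReal (256 * coneConst ^ 3 * t ^ 5) := by
        rw [zero_add, hK, ← ENNReal.ofReal_mul (by positivity), ← ENNReal.ofReal_mul (by positivity)]
        congr 1
        ring

/-- ★ **Haar-side triple bound**: `Haar³{‖[q₀,q₁]‖ ≤ t, ‖q₂q₁ + q₁q₂‖ ≤ t} ≤ 256·coneConst³·t⁵` for `0 < t ≤ 1`. [folklore] -/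
theorem haar_pi_minusTriple_le {t : ℝ} (ht : 0 < t) (ht1 : t ≤ 1) :
    (Measure.pi fun _ : Fin 3 => haarProbability SU2)
        {a : Fin 3 → SU2 | ‖su2Quat (a 0) * su2Quat (a 1) - su2Quat (a 1) * su2Quat (a 0)‖ ≤ t ∧
          ‖su2Quat (a 2) * su2Quat (a 1) + su2Quat (a 1) * su2Quat (a 2)‖ ≤ t} ≤
      ENNReal.ofReal (256 * coneConst ^ 3 * t ^ 5) := by
  haveI := isProbabilityMeasure_coneMeasure
  set E : Set (Fin 3 → SU2) := {a | ‖su2Quat (a 0) * su2Quat (a 1) - su2Quat (a 1) * su2Quat (a 0)‖ ≤ t ∧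
    ‖su2Quat (a 2) * su2Quat (a 1) + su2Quat (a 1) * su2Quat (a 2)‖ ≤ t} with hE
  have hEm : MeasurableSet E := by
    have hq : ∀ i : Fin 3, Measurable fun a : Fin 3 → SU2 => su2Quat (a i) := fun i => measurable_su2Quat.comp (measurable_pi_apply i)
    exact (measurableSet_le (((hq 0).mul (hq 1)).sub ((hq 1).mul (hq 0))).norm measurable_const).inter
      (measurableSet_le (((hq 2).mul (hq 1)).add ((hq 1).mul (hq 2))).norm measurable_const)
  rw [← measurePreserving_proj_three.measure_preimage hEm.nullMeasurableSet]
  refine (pi_cone_inter_piBall _).trans ((measure_mono ?_).trans (pi_cone_minusTriple_le ht ht1))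
  -- on the product of unit balls, the preimage of the unit event lies in the raw event
  rintro x ⟨hx, hball⟩
  simp only [Set.mem_preimage, hE, Set.mem_setOf_eq] at hx
  simp only [Set.mem_univ_pi, Metric.mem_ball, dist_zero_right] at hball
  obtain ⟨h01, h21⟩ := hx
  -- normalised letters
  have key : ∀ {i j : Fin 3} {σ : ℝ}, (σ = 1 ∨ σ = -1) →
      ‖su2Quat (quatToSU2 (x i)) * su2Quat (quatToSU2 (x j)) + σ • (su2Quat (quatToSU2 (x j)) * su2Quat (quatToSU2 (x i)))‖ ≤ t →
        ‖x i * x j + σ • (x j * x i)‖ ≤ t * ‖x i‖ * ‖x j‖ := by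
    intro i j σ hσ h
    by_cases hi : x i = 0
    · rw [hi]; simp
    by_cases hj : x j = 0
    · rw [hj]; simp
    rw [su2Quat_quatToSU2 hi, su2Quat_quatToSU2 hj] at h
    have hni : 0 < ‖x i‖ := norm_pos_iff.2 hi
    have hnj : 0 < ‖x j‖ := norm_pos_iff.2 hj
    have e : (‖x i‖⁻¹ • x i) * (‖x j‖⁻¹ • x j) + σ • ((‖x j‖⁻¹ • x j) * (‖x i‖⁻¹ • x i)) =
        (‖x i‖⁻¹ * ‖x j‖⁻¹) • (x i * x j + σ • (x j * x i)) := by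
      rw [smul_mul_smul_comm, smul_mul_smul_comm, smul_add, smul_comm, mul_comm ‖x j‖⁻¹]
    rw [e, norm_smul, Real.norm_eq_abs, abs_of_pos (by positivity)] at h
    have := mul_le_mul_of_nonneg_left h (mul_nonneg hni.le hnj.le)
    calc ‖x i * x j + σ • (x j * x i)‖ = ‖x i‖ * ‖x j‖ * (‖x i‖⁻¹ * ‖x j‖⁻¹ * ‖x i * x j + σ • (x j * x i)‖) := by
          field_simp
      _ ≤ ‖x i‖ * ‖x j‖ * t := this
      _ = t * ‖x i‖ * ‖x j‖ := by ring
  refine ⟨?_, ?_⟩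
  · have h := key (i := 0) (j := 1) (σ := -1) (Or.inr rfl) (by simpa [sub_eq_add_neg] using h01)
    have h' : ‖x 0 * x 1 - x 1 * x 0‖ ≤ t * ‖x 0‖ * ‖x 1‖ := by simpa [sub_eq_add_neg] using h
    refine h'.trans ?_
    have : t * ‖x 0‖ * ‖x 1‖ ≤ t * 1 * ‖x 1‖ := by gcongr; exact (hball 0).le
    linarith
  · have h := key (i := 2) (j := 1) (σ := 1) (Or.inl rfl) (by simpa using h21)
    simpa using h

/-! ## §3 The slaved letter: a quaternion ball has Haar mass `≤ 32t³` -/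

/-- `‖q(U) − 1‖² = 2 − Re tr U` for `U ∈ SU(2)`. [folklore] -/
theorem norm_su2Quat_sub_one_sq (U : SU2) : ‖su2Quat U - 1‖ ^ 2 = 2 - ((U : Matrix (Fin 2) (Fin 2) ℂ).trace).re := by
  rw [← quatMatrix_su2Quat U, trace_quatMatrix_re, sq_norm_eq_sum_sq]
  have h1 := normSq_su2Quat U
  rw [Quaternion.normSq_def'] at h1
  simp only [Quaternion.re_sub, Quaternion.imI_sub, Quaternion.imJ_sub, Quaternion.imK_sub, Quaternion.re_one, Quaternion.imI_one,
    Quaternion.imJ_one, Quaternion.imK_one, sub_zero]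
  nlinarith [h1]

/-- ★ **Quaternion balls are small**: `Haar{u : ‖q(D₁)q(u) − q(D₂)‖ ≤ t} ≤ 32t³` for all `D₁, D₂ ∈ SU(2)`, `t > 0` (left invariance +
✓`haarProbability_su2_two_sub_trace_lt_le`). [folklore] -/
theorem haar_quatBall_le (D₁ D₂ : SU2) {t : ℝ} (ht : 0 < t) :
    haarProbability SU2 {u : SU2 | ‖su2Quat D₁ * su2Quat u - su2Quat D₂‖ ≤ t} ≤ ENNReal.ofReal (32 * t ^ 3) := by
  haveI : (haarProbability SU2).IsMulLeftInvariant := by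
    rw [haarProbability_su2_eq_su2BallMeasure]; infer_instance
  have e : {u : SU2 | ‖su2Quat D₁ * su2Quat u - su2Quat D₂‖ ≤ t} =
      (fun u => D₂⁻¹ * D₁ * u) ⁻¹' {v : SU2 | ‖su2Quat v - 1‖ ≤ t} := by
    ext u
    simp only [Set.mem_setOf_eq, Set.mem_preimage]
    have h1 : su2Quat (D₂⁻¹ * D₁ * u) - 1 = su2Quat D₂⁻¹ * (su2Quat D₁ * su2Quat u - su2Quat D₂) := by
      rw [su2Quat_mul, su2Quat_mul, mul_sub, ← su2Quat_mul D₂⁻¹ D₂, inv_mul_cancel, su2Quat_one, mul_assoc]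
    rw [h1, norm_mul, norm_su2Quat, one_mul]
  have hsub : {v : SU2 | ‖su2Quat v - 1‖ ≤ t} ⊆ {v : SU2 | 2 - ((v : Matrix (Fin 2) (Fin 2) ℂ).trace).re < (2 * t) ^ 2} := by
    intro v hv
    have h1 : ‖su2Quat v - 1‖ ≤ t := hv
    show 2 - ((v : Matrix (Fin 2) (Fin 2) ℂ).trace).re < (2 * t) ^ 2
    rw [← norm_su2Quat_sub_one_sq]
    have h2 : ‖su2Quat v - 1‖ ^ 2 ≤ t ^ 2 := pow_le_pow_left₀ (norm_nonneg _) h1 2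
    nlinarith
  rw [e, show (fun u : SU2 => D₂⁻¹ * D₁ * u) ⁻¹' {v : SU2 | ‖su2Quat v - 1‖ ≤ t} =
      (fun u : SU2 => (D₂⁻¹ * D₁) * u) ⁻¹' {v : SU2 | ‖su2Quat v - 1‖ ≤ t} from rfl, measure_preimage_mul]
  refine (measure_mono hsub).trans ((haarProbability_su2_two_sub_trace_lt_le (by positivity : 0 < 2 * t)).trans (le_of_eq ?_))
  congr 1; ring

/-! ## §4 The four-letter event of the sectors `ε_c = −1` -/

/-- ★★ **THE `ε_c = −1` SECTORS ARE SUBLEADING.**  For every fixed `z ∈ SU(2)` (the sign `ε` of the exchanged relations: `z = 1` or `z = −1`) and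
`0 < t ≤ 1`: `Haar⁴{C | ‖[q(C 0), q(C 2)]‖ ≤ t ∧ ‖q(C 3)q(C 2) + q(C 2)q(C 3)‖ ≤ t ∧ ‖q(C 3)q(C 1) − q(z)q(C 0)q(C 3)‖ ≤ t} ≤ 8192·coneConst³·t⁸`.
The full σ-twisted event of a sector `(ε, ε, −)` (all of `[a,b], [a,c], [b,c]`, both exchanged relations, `tc ≈ −ct`) is a subset. [folklore] -/
theorem haar_pi_sigmaTwisted_minus_le (z : SU2) {t : ℝ} (ht : 0 < t) (ht1 : t ≤ 1) :
    (Measure.pi fun _ : Fin 4 => haarProbability SU2)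
        {C : Fin 4 → SU2 | ‖su2Quat (C 0) * su2Quat (C 2) - su2Quat (C 2) * su2Quat (C 0)‖ ≤ t ∧
          ‖su2Quat (C 3) * su2Quat (C 2) + su2Quat (C 2) * su2Quat (C 3)‖ ≤ t ∧
            ‖su2Quat (C 3) * su2Quat (C 1) - su2Quat z * su2Quat (C 0) * su2Quat (C 3)‖ ≤ t} ≤
      ENNReal.ofReal (8192 * coneConst ^ 3 * t ^ 8) := by
  -- split off the slaved letter `C 1`
  set T : Set (Fin 3 → SU2) := {a | ‖su2Quat (a 0) * su2Quat (a 1) - su2Quat (a 1) * su2Quat (a 0)‖ ≤ t ∧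
    ‖su2Quat (a 2) * su2Quat (a 1) + su2Quat (a 1) * su2Quat (a 2)‖ ≤ t} with hT
  have hq3 : ∀ i : Fin 3, Measurable fun a : Fin 3 → SU2 => su2Quat (a i) := fun i => measurable_su2Quat.comp (measurable_pi_apply i)
  have hTm : MeasurableSet T :=
    (measurableSet_le (((hq3 0).mul (hq3 1)).sub ((hq3 1).mul (hq3 0))).norm measurable_const).inter
      (measurableSet_le (((hq3 2).mul (hq3 1)).add ((hq3 1).mul (hq3 2))).norm measurable_const)
  set P : Set (SU2 × (Fin 3 → SU2)) :=
    {p | p.2 ∈ T ∧ ‖su2Quat (p.2 2) * su2Quat p.1 - su2Quat z * su2Quat (p.2 0) * su2Quat (p.2 2)‖ ≤ t} with hP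
  have hPm : MeasurableSet P := by
    have hq1 : Measurable fun p : SU2 × (Fin 3 → SU2) => su2Quat p.1 := measurable_su2Quat.comp measurable_fst
    have hq2 : ∀ i : Fin 3, Measurable fun p : SU2 × (Fin 3 → SU2) => su2Quat (p.2 i) := fun i =>
      measurable_su2Quat.comp ((measurable_pi_apply i).comp measurable_snd)
    exact (measurable_snd hTm).inter
      (measurableSet_le ((((hq2 2).mul hq1).sub ((measurable_const.mul (hq2 0)).mul (hq2 2))).norm) measurable_const)
  have hpres := measurePreserving_piFinSuccAbove (fun _ : Fin 4 => haarProbability SU2) 1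
  have hsub : {C : Fin 4 → SU2 | ‖su2Quat (C 0) * su2Quat (C 2) - su2Quat (C 2) * su2Quat (C 0)‖ ≤ t ∧
      ‖su2Quat (C 3) * su2Quat (C 2) + su2Quat (C 2) * su2Quat (C 3)‖ ≤ t ∧
        ‖su2Quat (C 3) * su2Quat (C 1) - su2Quat z * su2Quat (C 0) * su2Quat (C 3)‖ ≤ t} ⊆
      (MeasurableEquiv.piFinSuccAbove (fun _ : Fin 4 => SU2) 1) ⁻¹' P := by
    intro C hC
    exact ⟨⟨hC.1, hC.2.1⟩, hC.2.2⟩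
  refine (measure_mono hsub).trans ?_
  rw [hpres.measure_preimage hPm.nullMeasurableSet, Measure.prod_apply_symm hPm]
  -- sections over the triple are quaternion balls
  have hsec : ∀ a : Fin 3 → SU2, haarProbability SU2 ((fun u : SU2 => (u, a)) ⁻¹' P) ≤ T.indicator (fun _ => ENNReal.ofReal (32 * t ^ 3)) a := by
    intro a
    by_cases ha : a ∈ T
    · rw [Set.indicator_of_mem ha]
      have e : (fun u : SU2 => (u, a)) ⁻¹' P = {u : SU2 | ‖su2Quat (a 2) * su2Quat u - su2Quat (z * a 0 * a 2)‖ ≤ t} := by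
        ext u
        simp only [hP, Set.mem_preimage, Set.mem_setOf_eq, ha, true_and, su2Quat_mul]
      rw [e]
      exact haar_quatBall_le (a 2) (z * a 0 * a 2) ht
    · rw [Set.indicator_of_notMem ha]
      have e : (fun u : SU2 => (u, a)) ⁻¹' P = ∅ := by
        ext u
        simp only [hP, Set.mem_preimage, Set.mem_setOf_eq, ha, false_and, Set.mem_empty_iff_false]
      rw [e, measure_empty]
  calc ∫⁻ a, haarProbability SU2 ((fun u : SU2 => (u, a)) ⁻¹' P) ∂(Measure.pi fun _ : Fin 3 => haarProbability SU2)
      ≤ ∫⁻ a, T.indicator (fun _ => ENNReal.ofReal (32 * t ^ 3)) a ∂(Measure.pi fun _ : Fin 3 => haarProbability SU2) :=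
        lintegral_mono hsec
    _ = ENNReal.ofReal (32 * t ^ 3) * (Measure.pi fun _ : Fin 3 => haarProbability SU2) T := lintegral_indicator_const hTm _
    _ ≤ ENNReal.ofReal (32 * t ^ 3) * ENNReal.ofReal (256 * coneConst ^ 3 * t ^ 5) := by
        gcongr
        exact haar_pi_minusTriple_le ht ht1
    _ = ENNReal.ofReal (8192 * coneConst ^ 3 * t ^ 8) := by
        rw [← ENNReal.ofReal_mul (by positivity)]
        congr 1
        ring

end Summit.QuantumFields.YangMills.Theorems.SwapVirialDeficit.SigmaTwistedMinusSectorCeiling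

end
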